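import Summits.BirchSwinnertonDyer.BirchSwinnertonDyer.Theorems.ErratumRoadFiveRamFreeTamagawaDescent
import Summits.BirchSwinnertonDyer.BirchSwinnertonDyer.Theorems.CongruentShaFreeCutKatoKummerLogTorsion
import Summits.BirchSwinnertonDyer.Rank1Residual.Additive.LocalLogImageRat
import Summits.BirchSwinnertonDyer.Rank1Residual.Additive.LocalTorsionExponent
import Literature.NumberTheory.EllipticCurves.TamagawaRingEquivProofs
import Literature.NumberTheory.EllipticCurves.TamagawaPrimesEquivProofs
import HarnessLib

/-!
# `kato_Fframe_r4` — width stub S2ns PROVED from tree theorems (crux workfile, NOT a registration)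

Sorry-free proof of the statement of `stub_nonsplitLogMinimum` (S2ns, `Lines/kato_Fframe_r4.lean` rev 4
f94d5116aef1b815, l.301), verbatim, in a sibling namespace (`…KatoFframe.S2ns`), so that a width prover can
lift it into `Theorems/` unchanged and discharge `hS2n` of `EulerHalfNotRamNoInertSetAtFive_of`.
Chain (memo `Lines/kato_Fframe_r4_S2proofs.md` §1): non-split ⇒ `c_v ∈ {1,2}` (Tate's algorithm Step 2,
`localTamagawaNumber_of_hasNonsplitMultiplicativeReductionAt_holds`) ⇒ `p ∤ c_p` (`localTamagawaNumber_padic_eq_holds`);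
`#E(ℚ_p)_tors ∣ c_p · #Ẽ_ns(𝔽_p)` (`card_torsion_dvd_of_isMinimal`) and `p ∤ #Ẽ_ns(𝔽_p)` ⇒ `t = 0`; image of
`log` on `E(ℚ_p)` is `p^{1+t−v_p c_p} ℤ_p = p ℤ_p` (`range_padicLog_baseChange_of_mult`) ⇒ a point `Q` with
`log_ω Q = p` (`padicLogLocal_eq_padicLog`), valuation `1`.
Author: planner-bsd-idea-9 g39 (ideator; W-79: unregistered; no proposal). No summit statement / crux proved;
BSD proved for no curve. [cite: SilvermanAEC2009, IV.6.4, VII.2.1, VII.3.1, VII.6.1] [cite: SilvermanATAEC1994, IV.9.4 Step 2]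
-/

noncomputable section

open scoped Classical

set_option linter.dupNamespace false

namespace Summit.BirchSwinnertonDyer.BirchSwinnertonDyer.Cruxes.EulerHalfNotRamNoInertSetAtFive.KatoFframe.S2ns

open WeierstrassCurve IsDedekindDomain NumberField
open Literature.NumberTheory.EllipticCurves Literature.NumberTheory.EllipticCurves.Kato2004
open Literature.NumberTheory.EllipticCurves.Rank1Residual
open Summit.BirchSwinnertonDyer.Rank1Residual
open Summit.BirchSwinnertonDyer.Rank1Residual.X11b
open Summit.BirchSwinnertonDyer.Rank1Residual.Additive
open Summit.BirchSwinnertonDyer.BirchSwinnertonDyer.Theorems.CongruentShaFreeCutKatoKummerLogTorsion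

/-- **`p ∤ c_p(E ⊗ ℚ_p)` at a NON-SPLIT multiplicative prime `p ≠ 2`** (`c_p ∈ {1, 2}`, Tate's algorithm
Step 2, transported from the place `v ↔ p` to Mathlib's `ℚ_[p]`).
[cite: SilvermanATAEC1994, IV.9.4 Step 2 (PDF p. 344)] [cite: SilvermanAEC2009, VII.6 Ex. 7.6] -/
theorem not_dvd_localTamagawaNumber_padic_of_nonsplit (W : WeierstrassCurve ℚ) [W.IsElliptic]
    (p : ℕ) [Fact p.Prime] (hp2 : p ≠ 2) (hmult : W.HasMultiplicativeReductionAtPrime p)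
    (hns : ¬ W.HasSplitMultiplicativeReductionAtPrime p) :
    ¬ p ∣ (W.baseChange ℚ_[p]).localTamagawaNumber ℤ_[p] := by
  have hpP : p.Prime := Fact.out
  -- the finite place `v` of `ℚ` under `p`
  set v : HeightOneSpectrum (𝓞 ℚ) := Rat.HeightOneSpectrum.primesEquiv.symm ⟨p, hpP⟩ with hvdef
  have hv : (Rat.HeightOneSpectrum.primesEquiv v : ℕ) = p := by
    rw [hvdef, Equiv.apply_symm_apply]
  have hmult_v : W.HasMultiplicativeReductionAt v :=
    (hasMultiplicativeReductionAtPrime_primesEquiv_iff_holds W v p hv).mp hmult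
  have hns_v : ¬ W.HasSplitMultiplicativeReductionAt v :=
    BirchSwinnertonDyer.Theorems.RamFree.not_hasSplitMultiplicativeReductionAt_of_primesEquiv_eq W v hv hns
  haveI : Finite (IsLocalRing.ResidueField (v.adicCompletionIntegers ℚ)) :=
    HeightOneSpectrum.finite_residueField_adicCompletionIntegers ℚ v
  rw [WeierstrassCurve.localTamagawaNumber_padic_eq_holds W v p hv,
    localTamagawaNumber_of_hasNonsplitMultiplicativeReductionAt_holds v W hmult_v hns_v]
  intro hdvd
  split_ifs at hdvd
  · exact hp2 ((Nat.prime_dvd_prime_iff_eq hpP Nat.prime_two).mp hdvd)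
  · exact hpP.one_lt.ne' (Nat.dvd_one.mp hdvd)

/-- **`p ∤ #E(ℚ_p)_tors` at a non-split multiplicative `p ≥ 3`** (`#E(ℚ_p)_tors ∣ c_p · #Ẽ_ns(𝔽_p)`, both
factors prime to `p`). [cite: SilvermanAEC2009, VII.3 Prop. 3.1, VII.2.1, VII.6.1 and Exercise 3.5] -/
theorem padicValNat_card_torsion_eq_zero_of_nonsplit (W : WeierstrassCurve ℚ) [W.IsElliptic]
    [W.IsGloballyMinimal] (p : ℕ) [Fact p.Prime] (hp3 : 3 ≤ p)
    (hmult : W.HasMultiplicativeReductionAtPrime p) (hns : ¬ W.HasSplitMultiplicativeReductionAtPrime p) :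
    padicValNat p (Nat.card (AddCommGroup.torsion (W.baseChange ℚ_[p]).toAffine.Point)) = 0 := by
  have hpP : p.Prime := Fact.out
  refine padicValNat.eq_zero_of_not_dvd fun hdvd => ?_
  have hdiv := LocalLog.card_torsion_dvd_of_isMinimal (W.baseChange ℚ_[p]) hp3
  rw [LocalTorsion.natCard_point_reduction_baseChange_padic W p] at hdiv
  rcases (Nat.Prime.dvd_mul hpP).mp (dvd_trans hdvd hdiv) with h | h
  · exact not_dvd_localTamagawaNumber_padic_of_nonsplit W p (by omega) hmult hns h
  · exact LocalTorsion.not_dvd_reductionPointCount_of_mult W p hmult h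

/-- **S2ns, PROVED** — the statement of `stub_nonsplitLogMinimum` of `Lines/kato_Fframe_r4.lean` verbatim:
at a non-split multiplicative `p ≥ 5`, `ord_p c_p = 0` and some `Q ∈ E(ℚ_p)` has `log_ω(Q) ≠ 0` of valuation
exactly `1` (the image of `log_ω` on `E(ℚ_p)` is `p ℤ_p`).
[cite: SilvermanAEC2009, IV.6.4 (b), VII.2.2 and VII.6.1] [cite: SilvermanATAEC1994, IV.9.4 (Tate's algorithm, Step 2)] -/
theorem nonsplitLogMinimum :
    ∀ (W : WeierstrassCurve ℚ) [W.IsElliptic] [W.IsGloballyMinimal] (p : ℕ) [Fact p.Prime],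
      5 ≤ p → W.HasMultiplicativeReductionAtPrime p → ¬ W.HasSplitMultiplicativeReductionAtPrime p →
      padicValNat p ((W.baseChange ℚ_[p]).localTamagawaNumber ℤ_[p]) = 0 ∧
      ∃ Q : (W.baseChange ℚ_[p]).toAffine.Point, padicLogLocal W p Q ≠ 0 ∧
        (padicLogLocal W p Q).valuation = 1 := by
  intro W _ _ p _ h5 hmult hns
  have hpP : p.Prime := Fact.out
  have hc0 : padicValNat p ((W.baseChange ℚ_[p]).localTamagawaNumber ℤ_[p]) = 0 :=
    padicValNat.eq_zero_of_not_dvd (not_dvd_localTamagawaNumber_padic_of_nonsplit W p (by omega) hmult hns)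
  have ht0 := padicValNat_card_torsion_eq_zero_of_nonsplit W p (by omega) hmult hns
  refine ⟨hc0, ?_⟩
  -- the image of `log` on `E(ℚ_p)` is `p ℤ_p`
  have hrange := LocalLog.range_padicLog_baseChange_of_mult W p hmult
  rw [ht0, hc0, Nat.cast_zero, add_zero, sub_zero, zpow_one] at hrange
  have hmem : (p : ℚ_[p]) ∈ (LocalLog.padicLog (W.baseChange ℚ_[p])).range := by
    rw [hrange]
    exact Submodule.mem_span_singleton_self _
  obtain ⟨Q, hQ⟩ := AddMonoidHom.mem_range.mp hmem
  refine ⟨Q, ?_, ?_⟩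
  · rw [padicLogLocal_eq_padicLog W p Q, hQ]
    exact_mod_cast hpP.ne_zero
  · rw [padicLogLocal_eq_padicLog W p Q, hQ]
    exact Padic.valuation_p

end Summit.BirchSwinnertonDyer.BirchSwinnertonDyer.Cruxes.EulerHalfNotRamNoInertSetAtFive.KatoFframe.S2ns
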